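import Summits.AtomisticToContinuum.Crystallization.Theorems.TwoCentreKissingKernelRobustTangencyBoundCornerAlgebra
import Summits.AtomisticToContinuum.Crystallization.Theorems.TwoCentreKissingKernelRobustTangencyBoundRhombusCert
import HarnessLib

/-!
# `RobustTangencyBound` — the isolated-rhombus system: corners in forward form, the candidate
# solution, and the algebraic core (step (III), robust Bezdek–Reid Lemma 4)

Route `TwoCentreKissingKernel`, item `stmt-AtomisticToContinuum-12082`, blueprint (III) §5–6.  The middle layer between the
geometry (`…RhombusIsolated.lean`) and the kernel certificates `rhombusClaim_holds`
(`…RhombusCert.lean`):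

* `corner_forward` — a facet corner `φ = ∠(t_y u, t_y w)` in forward form
  `cos φ = N (√D²)⁻¹`, `sin φ = √(1 − cos² φ)` (`N = ⟪u,w⟫ − ⟪y,u⟫⟪y,w⟫`, `D² = (1−⟪y,u⟫²)(1−⟪y,w⟫²)`);
* `zOf`, `zOf_cprodR`, `eval_cornerR`, `zOf_cornerR` — evaluation of the system's terms;
* `InIvl`, `boxmem_of_forall₂`, `mkPt` (the candidate solution `x, s₁..s₄`, then the `(C, S)` pairs
  of the regular corners at `v`, then at `a`), `mkPt_base/_v/_a`, `mkPt_mem_rhombusBox`,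
  `map_zOf_regVars_v/_a`;
* `rhombus_core_false` — admissible data (windows, unit circles, the two vertex conditions in
  product form) would solve `rhombusClaim m_v m_a` in its box: contradiction.
-/

noncomputable section

namespace Summit.AtomisticToContinuum.Crystallization.Theorems

open Real RealInnerProductSpace InnerProductGeometry Literature.Geometry.DiscreteGeometry
  Literature.Analysis.ValidatedNumerics Finset

/-! ### Corners in forward form, and the evaluation of the system's terms -/

/-- **A corner in forward form**: with `N = ⟪u,w⟫ − ⟪y,u⟫⟪y,w⟫` and `D² = (1 − ⟪y,u⟫²)(1 − ⟪y,w⟫²)`,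
`cos φ = N · (√D²)⁻¹` and `sin φ = √(1 − (N · (√D²)⁻¹)²)` for `φ = ∠(t_y u, t_y w)`. -/
theorem corner_forward {y u w : EuclideanSpace ℝ (Fin 3)} (hy : ‖y‖ = 1) (hu : ‖u‖ = 1)
    (hw : ‖w‖ = 1) (hyu : ⟪y, u⟫ ^ 2 < 1) (hyw : ⟪y, w⟫ ^ 2 < 1) :
    Real.cos (angle (perpTo y u) (perpTo y w)) =
      (⟪u, w⟫ - ⟪y, u⟫ * ⟪y, w⟫) * (Real.sqrt ((1 - ⟪y, u⟫ ^ 2) * (1 - ⟪y, w⟫ ^ 2)))⁻¹ ∧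
    Real.sin (angle (perpTo y u) (perpTo y w)) =
      Real.sqrt (1 - ((⟪u, w⟫ - ⟪y, u⟫ * ⟪y, w⟫) *
        (Real.sqrt ((1 - ⟪y, u⟫ ^ 2) * (1 - ⟪y, w⟫ ^ 2)))⁻¹) ^ 2) := by
  obtain ⟨hD, hD2, hCD, hS0, hS2⟩ := corner_package hy hu hw hyu hyw
  have hsq : Real.sqrt ((1 - ⟪y, u⟫ ^ 2) * (1 - ⟪y, w⟫ ^ 2)) =
      ‖tangentProj y u‖ * ‖tangentProj y w‖ := by
    rw [← hD2, Real.sqrt_sq hD.le]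
  have hC : Real.cos (angle (perpTo y u) (perpTo y w)) =
      (⟪u, w⟫ - ⟪y, u⟫ * ⟪y, w⟫) * (Real.sqrt ((1 - ⟪y, u⟫ ^ 2) * (1 - ⟪y, w⟫ ^ 2)))⁻¹ := by
    rw [hsq, ← hCD, mul_inv_cancel_right₀ hD.ne']
  refine ⟨hC, ?_⟩
  rw [← hC, ← hS2, Real.sqrt_sq hS0]

/-- Evaluation of `cornerR`. -/
theorem eval_cornerR (N Dsq : RExpr) (p : ℕ → ℝ) :
    (cornerR N Dsq).1.eval p = N.eval p * (Real.sqrt (Dsq.eval p))⁻¹ ∧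
    (cornerR N Dsq).2.eval p = Real.sqrt (1 - (N.eval p * (Real.sqrt (Dsq.eval p))⁻¹) ^ 2) := by
  simp [cornerR, RExpr.eval]

/-- The complex number `re + im·I` of a pair of terms at a point. -/
def zOf (p : ℕ → ℝ) (q : RExpr × RExpr) : ℂ := (q.1.eval p : ℂ) + (q.2.eval p : ℂ) * Complex.I

/-- Evaluation of `cprodR`: the pair evaluates to the complex product. -/
theorem zOf_cprodR (p : ℕ → ℝ) : ∀ l : List (RExpr × RExpr), zOf p (cprodR l) = (l.map (zOf p)).prod
  | [] => by simp [zOf, cprodR, RExpr.eval]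
  | q :: l => by
    rw [cprodR, List.map_cons, List.prod_cons, ← zOf_cprodR p l]
    simp only [zOf, cmulR, RExpr.eval]
    push_cast
    ring_nf
    rw [Complex.I_sq]
    ring

/-! ### The point of the box, as a list, and its coordinates -/

/-- The pointwise box relation between a coordinate interval and a real number. -/
def InIvl (I : ℚ × ℚ) (r : ℝ) : Prop := (I.1 : ℝ) ≤ r ∧ r ≤ (I.2 : ℝ)

/-- A list of reals pointwise inside a list of intervals gives a point of the box (coordinates
beyond the list are `0 ∈ [0, 0]`). -/
theorem boxmem_of_forall₂ {B : Box} {L : List ℝ} (h : List.Forall₂ InIvl B L) :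
    Box.mem B (fun i => L.getD i 0) := by
  intro i
  induction h generalizing i with
  | nil => simp [Box.ivl]
  | cons hIr _ ih =>
    cases i with
    | zero => simpa [Box.ivl, InIvl] using hIr
    | succ j => simpa [Box.ivl] using ih j

/-- `Forall₂` along concatenations. -/
theorem forall₂_append {R : ℚ × ℚ → ℝ → Prop} {l₁ l₂ : List (ℚ × ℚ)} {m₁ m₂ : List ℝ}
    (h₁ : List.Forall₂ R l₁ m₁) (h₂ : List.Forall₂ R l₂ m₂) : List.Forall₂ R (l₁ ++ l₂) (m₁ ++ m₂) := by
  induction h₁ with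
  | nil => simpa using h₂
  | cons h _ ih => exact List.Forall₂.cons h ih

/-- The regular-corner block: if every `c ∈ l` has `(C c, S c)` in the window box `[I, J]`, the
flattened pairs lie pointwise in `replicate |l| [I, J]` flattened. -/
theorem forall₂_pairs {α : Type*} {I J : ℚ × ℚ} {C S : α → ℝ} :
    ∀ l : List α, (∀ c ∈ l, InIvl I (C c) ∧ InIvl J (S c)) →
      List.Forall₂ InIvl (List.replicate l.length [I, J]).flatten ((l.map fun c => [C c, S c]).flatten)
  | [], _ => by simp
  | c :: l, h => by
    rw [List.length_cons, List.replicate_succ, List.flatten_cons, List.map_cons, List.flatten_cons]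
    refine forall₂_append ?_ (forall₂_pairs l fun c' hc' => h c' (List.mem_cons_of_mem _ hc'))
    obtain ⟨h1, h2⟩ := h c List.mem_cons_self
    exact List.Forall₂.cons h1 (List.Forall₂.cons h2 List.Forall₂.nil)

/-- Even entries of a flattened list of pairs. -/
theorem getD_pairs_even {α : Type*} {C S : α → ℝ} (d : α) :
    ∀ (l : List α) (j : ℕ), j < l.length →
      ((l.map fun c => [C c, S c]).flatten).getD (2 * j) 0 = C (l.getD j d)
  | [], j, hj => by simp at hj
  | c :: l, 0, _ => by simp
  | c :: l, j + 1, hj => by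
    rw [List.map_cons, List.flatten_cons, show 2 * (j + 1) = 2 * j + 2 by ring,
      show [C c, S c] ++ (List.map (fun c => [C c, S c]) l).flatten =
        C c :: S c :: (List.map (fun c => [C c, S c]) l).flatten from rfl]
    simp only [List.getD_cons_succ]
    exact getD_pairs_even d l j (by simpa using hj)

/-- Odd entries of a flattened list of pairs. -/
theorem getD_pairs_odd {α : Type*} {C S : α → ℝ} (d : α) :
    ∀ (l : List α) (j : ℕ), j < l.length →
      ((l.map fun c => [C c, S c]).flatten).getD (2 * j + 1) 0 = S (l.getD j d)
  | [], j, hj => by simp at hj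
  | c :: l, 0, _ => by simp
  | c :: l, j + 1, hj => by
    rw [List.map_cons, List.flatten_cons, show 2 * (j + 1) + 1 = (2 * j + 1) + 2 by ring,
      show [C c, S c] ++ (List.map (fun c => [C c, S c]) l).flatten =
        C c :: S c :: (List.map (fun c => [C c, S c]) l).flatten from rfl]
    simp only [List.getD_cons_succ]
    exact getD_pairs_odd d l j (by simpa using hj)

/-- Length of a flattened list of pairs. -/
theorem length_pairs {α : Type*} {C S : α → ℝ} (l : List α) :
    ((l.map fun c => [C c, S c]).flatten).length = 2 * l.length := by
  induction l with
  | nil => simp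
  | cons c l ih => simp [ih]; ring

/-- **The candidate solution**: the coordinates `x, s₁, s₂, s₃, s₄`, then the `(C, S)` pairs of the
regular corners at `v` (indexed by the list `Lv`), then those at `a` (list `La`). -/
def mkPt {α : Type*} (x s₁ s₂ s₃ s₄ : ℝ) (Lv La : List α) (Cv Sv Ca Sa : α → ℝ) : ℕ → ℝ :=
  fun i => ([x, s₁, s₂, s₃, s₄] ++ (Lv.map fun c => [Cv c, Sv c]).flatten ++
    (La.map fun c => [Ca c, Sa c]).flatten).getD i 0

section MkPt

variable {α : Type*} (x s₁ s₂ s₃ s₄ : ℝ) (Lv La : List α) (Cv Sv Ca Sa : α → ℝ) (d : α)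

/-- The first five coordinates. -/
theorem mkPt_base :
    mkPt x s₁ s₂ s₃ s₄ Lv La Cv Sv Ca Sa 0 = x ∧ mkPt x s₁ s₂ s₃ s₄ Lv La Cv Sv Ca Sa 1 = s₁ ∧
    mkPt x s₁ s₂ s₃ s₄ Lv La Cv Sv Ca Sa 2 = s₂ ∧ mkPt x s₁ s₂ s₃ s₄ Lv La Cv Sv Ca Sa 3 = s₃ ∧
    mkPt x s₁ s₂ s₃ s₄ Lv La Cv Sv Ca Sa 4 = s₄ := by
  simp [mkPt]

/-- The `v`-block coordinates. -/
theorem mkPt_v {j : ℕ} (hj : j < Lv.length) :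
    mkPt x s₁ s₂ s₃ s₄ Lv La Cv Sv Ca Sa (5 + 2 * j) = Cv (Lv.getD j d) ∧
    mkPt x s₁ s₂ s₃ s₄ Lv La Cv Sv Ca Sa (5 + 2 * j + 1) = Sv (Lv.getD j d) := by
  have hb5 : ([x, s₁, s₂, s₃, s₄] : List ℝ).length = 5 := by simp
  have hbl : ((Lv.map fun c => [Cv c, Sv c]).flatten).length = 2 * Lv.length := length_pairs Lv
  constructor
  · simp only [mkPt]
    rw [List.append_assoc, List.getD_append_right _ _ _ _ (by rw [hb5]; omega), hb5,
      show 5 + 2 * j - 5 = 2 * j by omega, List.getD_append _ _ _ _ (by rw [hbl]; omega),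
      getD_pairs_even d Lv j hj]
  · simp only [mkPt]
    rw [List.append_assoc, List.getD_append_right _ _ _ _ (by rw [hb5]; omega), hb5,
      show 5 + 2 * j + 1 - 5 = 2 * j + 1 by omega, List.getD_append _ _ _ _ (by rw [hbl]; omega),
      getD_pairs_odd d Lv j hj]

/-- The `a`-block coordinates. -/
theorem mkPt_a {j : ℕ} (hj : j < La.length) :
    mkPt x s₁ s₂ s₃ s₄ Lv La Cv Sv Ca Sa (5 + 2 * Lv.length + 2 * j) = Ca (La.getD j d) ∧
    mkPt x s₁ s₂ s₃ s₄ Lv La Cv Sv Ca Sa (5 + 2 * Lv.length + 2 * j + 1) = Sa (La.getD j d) := by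
  have hb5 : (([x, s₁, s₂, s₃, s₄] : List ℝ) ++ (Lv.map fun c => [Cv c, Sv c]).flatten).length =
      5 + 2 * Lv.length := by
    rw [List.length_append, length_pairs]; simp
  constructor
  · simp only [mkPt]
    rw [List.getD_append_right _ _ _ _ (by rw [hb5]; omega), hb5,
      show 5 + 2 * Lv.length + 2 * j - (5 + 2 * Lv.length) = 2 * j by omega, getD_pairs_even d La j hj]
  · simp only [mkPt]
    rw [List.getD_append_right _ _ _ _ (by rw [hb5]; omega), hb5,
      show 5 + 2 * Lv.length + 2 * j + 1 - (5 + 2 * Lv.length) = 2 * j + 1 by omega,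
      getD_pairs_odd d La j hj]

/-- **The candidate solution lies in the box** when its coordinates lie in their windows. -/
theorem mkPt_mem_rhombusBox (hx : InIvl (((-3454 : ℚ)) / 10000, (502 : ℚ) / 1000) x)
    (h₁ : InIvl ((497 : ℚ) / 1000, (502 : ℚ) / 1000) s₁) (h₂ : InIvl ((497 : ℚ) / 1000, (502 : ℚ) / 1000) s₂)
    (h₃ : InIvl ((497 : ℚ) / 1000, (502 : ℚ) / 1000) s₃) (h₄ : InIvl ((497 : ℚ) / 1000, (502 : ℚ) / 1000) s₄)
    (hv : ∀ c ∈ Lv, InIvl ((3252 : ℚ) / 10000, (3415 : ℚ) / 10000) (Cv c) ∧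
      InIvl ((9398 : ℚ) / 10000, (9457 : ℚ) / 10000) (Sv c))
    (ha : ∀ c ∈ La, InIvl ((3252 : ℚ) / 10000, (3415 : ℚ) / 10000) (Ca c) ∧
      InIvl ((9398 : ℚ) / 10000, (9457 : ℚ) / 10000) (Sa c)) :
    Box.mem (rhombusBox Lv.length La.length) (mkPt x s₁ s₂ s₃ s₄ Lv La Cv Sv Ca Sa) := by
  apply boxmem_of_forall₂
  rw [rhombusBox, List.replicate_add, List.flatten_append, ← List.append_assoc]
  refine forall₂_append (forall₂_append ?_ (forall₂_pairs Lv hv)) (forall₂_pairs La ha)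
  simp only [List.replicate, List.cons_append, List.nil_append]
  exact List.Forall₂.cons hx (List.Forall₂.cons h₁ (List.Forall₂.cons h₂
    (List.Forall₂.cons h₃ (List.Forall₂.cons h₄ List.Forall₂.nil))))

/-- The regular block at `v` of the system evaluates to the given complex numbers. -/
theorem map_zOf_regVars_v :
    (regVars 5 Lv.length).map (zOf (mkPt x s₁ s₂ s₃ s₄ Lv La Cv Sv Ca Sa)) =
      Lv.map fun c => ((Cv c : ℂ) + (Sv c : ℂ) * Complex.I) := by
  apply List.ext_getElem
  · simp [regVars]
  · intro j h1 h2
    have hj : j < Lv.length := by simpa [regVars] using h1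
    obtain ⟨e1, e2⟩ := mkPt_v x s₁ s₂ s₃ s₄ Lv La Cv Sv Ca Sa (Lv[j]) hj
    simp only [regVars, List.getElem_map, List.getElem_range, zOf, RExpr.eval]
    rw [e1, e2, List.getD_eq_getElem _ _ hj]

/-- The regular block at `a` of the system evaluates to the given complex numbers. -/
theorem map_zOf_regVars_a :
    (regVars (5 + 2 * Lv.length) La.length).map (zOf (mkPt x s₁ s₂ s₃ s₄ Lv La Cv Sv Ca Sa)) =
      La.map fun c => ((Ca c : ℂ) + (Sa c : ℂ) * Complex.I) := by
  apply List.ext_getElem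
  · simp [regVars]
  · intro j h1 h2
    have hj : j < La.length := by simpa [regVars] using h1
    obtain ⟨e1, e2⟩ := mkPt_a x s₁ s₂ s₃ s₄ Lv La Cv Sv Ca Sa (La[j]) hj
    simp only [regVars, List.getElem_map, List.getElem_range, zOf, RExpr.eval]
    rw [e1, e2, List.getD_eq_getElem _ _ hj]

/-- `zOf` of a forward corner, at the candidate point (coordinates `i, j, k ≤ 4` for `x, sᵢ`). -/
theorem zOf_cornerR (N Dsq : RExpr) (p : ℕ → ℝ) :
    zOf p (cornerR N Dsq) = ((N.eval p * (Real.sqrt (Dsq.eval p))⁻¹ : ℝ) : ℂ) +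
      ((Real.sqrt (1 - (N.eval p * (Real.sqrt (Dsq.eval p))⁻¹) ^ 2) : ℝ) : ℂ) * Complex.I := by
  obtain ⟨e1, e2⟩ := eval_cornerR N Dsq p
  rw [zOf, e1, e2]

end MkPt

/-- **The algebraic core**: no admissible data solve the system. Given reals `x, s₁, …, s₄` in their
windows, lists `Lv, La` (lengths `≤ 5`) of regular corners with `(C, S)` in the windows and on the
unit circle, and complex numbers `z₁ = zOf pt phi1R`, `z₂ = zOf pt phi2R`, `z_b = zOf pt betaR`
satisfying the two vertex conditions, we get `False` from `rhombusClaim_holds`. -/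
theorem rhombus_core_false {α : Type*} {x s₁ s₂ s₃ s₄ : ℝ} {Lv La : List α} {Cv Sv Ca Sa : α → ℝ}
    (hmv : Lv.length ≤ 5) (hma : La.length ≤ 5)
    (hx : InIvl (((-3454 : ℚ)) / 10000, (502 : ℚ) / 1000) x)
    (h₁ : InIvl ((497 : ℚ) / 1000, (502 : ℚ) / 1000) s₁) (h₂ : InIvl ((497 : ℚ) / 1000, (502 : ℚ) / 1000) s₂)
    (h₃ : InIvl ((497 : ℚ) / 1000, (502 : ℚ) / 1000) s₃) (h₄ : InIvl ((497 : ℚ) / 1000, (502 : ℚ) / 1000) s₄)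
    (hv : ∀ c ∈ Lv, InIvl ((3252 : ℚ) / 10000, (3415 : ℚ) / 10000) (Cv c) ∧
      InIvl ((9398 : ℚ) / 10000, (9457 : ℚ) / 10000) (Sv c))
    (ha : ∀ c ∈ La, InIvl ((3252 : ℚ) / 10000, (3415 : ℚ) / 10000) (Ca c) ∧
      InIvl ((9398 : ℚ) / 10000, (9457 : ℚ) / 10000) (Sa c))
    (hcv : ∀ c ∈ Lv, Sv c ^ 2 + Cv c ^ 2 = 1) (hca : ∀ c ∈ La, Sa c ^ 2 + Ca c ^ 2 = 1)
    (hprodv : zOf (mkPt x s₁ s₂ s₃ s₄ Lv La Cv Sv Ca Sa) phi1R *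
      (zOf (mkPt x s₁ s₂ s₃ s₄ Lv La Cv Sv Ca Sa) phi2R *
        (Lv.map fun c => ((Cv c : ℂ) + (Sv c : ℂ) * Complex.I)).prod) = 1)
    (hproda : zOf (mkPt x s₁ s₂ s₃ s₄ Lv La Cv Sv Ca Sa) betaR *
      (La.map fun c => ((Ca c : ℂ) + (Sa c : ℂ) * Complex.I)).prod = 1) : False := by
  have hmem := mkPt_mem_rhombusBox x s₁ s₂ s₃ s₄ Lv La Cv Sv Ca Sa hx h₁ h₂ h₃ h₄ hv ha
  have hprodv' : zOf (mkPt x s₁ s₂ s₃ s₄ Lv La Cv Sv Ca Sa) (cprodR ([phi1R, phi2R] ++ regVars 5 Lv.length)) = 1 := by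
    rw [zOf_cprodR, List.map_append, List.prod_append, map_zOf_regVars_v, List.map_cons,
      List.map_cons, List.map_nil, List.prod_cons, List.prod_cons, List.prod_nil, mul_one]
    simpa only [mul_assoc] using hprodv
  have hproda' : zOf (mkPt x s₁ s₂ s₃ s₄ Lv La Cv Sv Ca Sa) (cprodR ([betaR] ++ regVars (5 + 2 * Lv.length) La.length)) = 1 := by
    rw [zOf_cprodR, List.map_append, List.prod_append, map_zOf_regVars_a, List.map_cons,
      List.map_nil, List.prod_cons, List.prod_nil, mul_one]
    exact hproda
  have hre_im : ∀ {q : RExpr × RExpr}, zOf (mkPt x s₁ s₂ s₃ s₄ Lv La Cv Sv Ca Sa) q = 1 →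
      q.1.eval (mkPt x s₁ s₂ s₃ s₄ Lv La Cv Sv Ca Sa) = 1 ∧ q.2.eval (mkPt x s₁ s₂ s₃ s₄ Lv La Cv Sv Ca Sa) = 0 := by
    intro q h
    have h1 := congrArg Complex.re h
    have h2 := congrArg Complex.im h
    simp [zOf] at h1 h2
    exact ⟨h1, h2⟩
  obtain ⟨hv1, hv2⟩ := hre_im hprodv'
  obtain ⟨ha1, ha2⟩ := hre_im hproda'
  have hhs : ∀ e ∈ rhombusHs Lv.length La.length, e.eval (mkPt x s₁ s₂ s₃ s₄ Lv La Cv Sv Ca Sa) = 0 := by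
    intro e he
    rw [rhombusHs, List.mem_append, List.mem_map] at he
    rcases he with ⟨q, hq, rfl⟩ | he
    · rw [List.mem_append] at hq
      rcases hq with hq | hq
      · simp only [regVars, List.mem_map, List.mem_range] at hq
        obtain ⟨j, hj, rfl⟩ := hq
        obtain ⟨e1, e2⟩ := mkPt_v x s₁ s₂ s₃ s₄ Lv La Cv Sv Ca Sa (Lv[j]) hj
        simp only [RExpr.eval]
        rw [e1, e2, hcv _ (by rw [List.getD_eq_getElem _ _ hj]; exact List.getElem_mem hj)]
        ring
      · simp only [regVars, List.mem_map, List.mem_range] at hq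
        obtain ⟨j, hj, rfl⟩ := hq
        obtain ⟨e1, e2⟩ := mkPt_a x s₁ s₂ s₃ s₄ Lv La Cv Sv Ca Sa (La[j]) hj
        simp only [RExpr.eval]
        rw [e1, e2, hca _ (by rw [List.getD_eq_getElem _ _ hj]; exact List.getElem_mem hj)]
        ring
    · simp only [List.mem_cons, List.mem_nil_iff, or_false] at he
      rcases he with rfl | rfl | rfl | rfl
      · simp only [RExpr.eval]; rw [hv1]; norm_num
      · exact hv2
      · simp only [RExpr.eval]; rw [ha1]; norm_num
      · exact ha2
  exact rhombusClaim_holds Lv.length La.length hmv hma _ hmem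
    ⟨fun g hg => by simp [rhombusClaim] at hg, hhs⟩

end Summit.AtomisticToContinuum.Crystallization.Theorems

end
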